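import Summits.BirchSwinnertonDyer.BirchSwinnertonDyer.Theorems.CMKolyvaginAtInertTwoShaCountRegulatorAtTwo
import Summits.BirchSwinnertonDyer.BirchSwinnertonDyer.Theorems.CMKolyvaginAtInertTwoShaCountTorsionAtTwo
import Summits.BirchSwinnertonDyer.BirchSwinnertonDyer.Theorems.CMKolyvaginAtInertTwoShaCountTamagawaBaseChangeAtTwo
import Summits.BirchSwinnertonDyer.BirchSwinnertonDyer.Theorems.CMKolyvaginAtInertTwoShaCountTamagawaTwistAtTwo
import Summits.BirchSwinnertonDyer.Rank1Residual.AdditivePotMult.QuadraticBaseChangeMilneQuotientAnyRank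
import Literature.NumberTheory.EllipticCurves.Milne1972.WeilRestrictionQuadraticBSDQuotientAnyModel
import Literature.NumberTheory.EllipticCurves.GlobalMinimalModelHeegnerBaseChangeProofs
import Literature.NumberTheory.EllipticCurves.BSDInvariantsPositivityProofs
import HarnessLib

/-!
# Route `CMKolyvaginAtInertTwo`, crux `CMKolyvaginExactAtInertTwo` (stmt-BirchSwinnertonDyer-24277):
# THE COUNT IDENTITY `#Ш(E/K)[2^∞] = #Ш(E/ℚ)[2^∞] · #Ш(E^{(d_K)}/ℚ)[2^∞]`, IV — assembly
# (modulo Milne's Weil-restriction theorem, the route's support item `MilneAnyModel`)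

Seat `bsd-line-cmk2-p1` g15 (cell `bsd-print-cf2`); helper (`--supports stmt-BirchSwinnertonDyer-24277`).
THEOREMS ONLY: no definition, no named fact, no `sorry`; the named fact
`Milne1972.bsdQuotient_baseChange_quadratic_anyModel` (Milne 1972 Thm. 1 + isogeny invariance, the
route's item stmt-BirchSwinnertonDyer-24149 `MilneAnyModel`) is a HYPOTHESIS (`hMilneC`), so every
theorem here is CONDITIONAL on it; no item is closed; BSD is not proved by this.

WHAT. KERNEL-STATUS §13.4 / MEMO-T2 §4 of the crux folder name ONE input of the final assembly of
24277 that was not in the tree: the passage from the pair `(Ш(E/ℚ), Ш(E^{(d_K)}/ℚ))`, which the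
`p = 2` telescope bounds (`…PairTelescopeBoundOfInjectiveAtTwo`, g14), to `Ш(E_K/K)`, which the crux
counts. On the habitat — `W/ℚ` globally minimal with `Δ < 0`, `K` imaginary quadratic with `|d_K| = q`
an odd PRIME at which Frobenius is a transposition on `E[2]` (`(Δ/q) = −1`), the Heegner hypothesis,
no point of order `2` in `E(K)`, total rank `rank E(ℚ) + rank E^{(d_K)}(ℚ) = 1`, `Ш(E/ℚ)` and
`Ш(E^{(d_K)}/ℚ)` finite — Milne's identity of BSD quotients
`#Ш(E_K)·Reg(E_K)·Ω(E_K)·C(E_K)/#E(K)_t² = RHS(E)·RHS(E^{(d_K)})` becomes, after the archimedean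
comparison `Ω(E)Ω(E^{(d_K)}) = n_E Ω(E_K)` (tree) and the cross-multiplication of cell `b2b-bsdres`'
`milneQuotient_mul_eq_of_arch_of_regulator_gen`, an identity of natural numbers in which every factor
but the three `Ш`'s is known EXACTLY at `2`: `n_E = 1` (`Δ < 0`), `|u_d| = 1`, `Reg(E_K) =
2·Reg(E)·Reg(E_d)` (file I), `#E(K)_t = #E(ℚ)_t·#E_d(ℚ)_t` (file II), `∏c(E_K) = (∏c(E))²` (IIIa),
`ord₂ ∏c(E_d) = ord₂ ∏c(E) + 1` (IIIb). The two extra factors `2` (regulator, `c_q(E_d) = 2`) sit on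
opposite sides and cancel: `ord₂ #Ш(E_K) = ord₂ #Ш(E) + ord₂ #Ш(E_d)`.

* `natIdentity_of_milne` — the identity of naturals
  `#Ш(E)·#Ш(E_d)·∏c(E)·∏c(E_d)·#E_K,t² = #Ш(E_K)·∏c(E_K)·#E_t²·#E_d,t²·2` on the habitat;
* `padicValNat_two_shaOrder_baseChange_eq_add_of_milne` — `ord₂ #Ш(E_K) = ord₂ #Ш(E) + ord₂ #Ш(E_d)`;
* `card_primaryComponent_sha_two_baseChange_eq_mul_of_milne` —
  **`#Ш(E_K)[2^∞] = #Ш(E)[2^∞] · #Ш(E_d)[2^∞]`** (and `Ш(E_K)` is finite).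

References: Milne 1972 §1 Thm. 1; Dokchitser–Dokchitser 2010 §2.1; Gross–Zagier 1986 V.§2; Kramer
1981 Prop. 3; Gross 1991 (*Kolyvagin's work*) §2.
-/

-- single-conjunct summit: `Summit.BirchSwinnertonDyer.BirchSwinnertonDyer.…` repeats the name by design
set_option linter.dupNamespace false
set_option autoImplicit false

noncomputable section

open scoped Classical

open WeierstrassCurve NumberField Literature.NumberTheory.EllipticCurves
  Literature.NumberTheory.QuadraticFields Summit.BirchSwinnertonDyer.Rank1Residual.AdditivePotMult

namespace Summit.BirchSwinnertonDyer.BirchSwinnertonDyer.Theorems.ShaCountTwo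

variable (W : WeierstrassCurve ℚ) [W.IsElliptic] [W.IsGloballyMinimal]
  (K : Type) [Field K] [NumberField K] (hK : IsImaginaryQuadratic K)
  (hodd : Odd (NumberField.discr K)) (hH : SatisfiesHeegnerHypothesis (W.conductorNorm ℤ) K)
  (hΔ : W.Δ < 0)
  (Wd : WeierstrassCurve ℚ) [Wd.IsElliptic] [Wd.IsGloballyMinimal] (Cd : VariableChange ℚ)
  (hWd : Cd • W.quadraticTwist (NumberField.discr K : ℚ) = Wd) (hu : |(Cd.u : ℚ)| = 1)
  (hr : W.mordellWeilRank + Wd.mordellWeilRank = 1)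
  (h2t : ∀ P : (W.baseChange K).toAffine.Point, (2 : ℕ) • P = 0 → P = 0)

include hK hH hΔ hWd hu hr h2t in
/-- **The identity of natural numbers behind the count identity** (modulo Milne). On the habitat of
the module docstring: `Ш(E_K)` is finite and
`#Ш(E)·#Ш(E_d)·∏c(E)·∏c(E_d)·#E(K)_t² = #Ш(E_K)·∏c(E_K)·#E(ℚ)_t²·#E_d(ℚ)_t²·2` — Milne's
quotient identity (`hMilneC`, on the canonical model `W ⊗ K`, whose `C(E_K)` is the plain Tamagawa
product by `modifiedTamagawaProduct_baseChange_eq_tamagawaProduct_of_satisfiesHeegnerHypothesis`),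
cross-multiplied by `milneQuotient_mul_eq_of_arch_of_regulator_gen` with the archimedean factor
`n_E = 1` (`Δ < 0`) and the exact regulator factor `(m, k) = (1, 2)` (file I), `|u_d| = 1`,
`|N(u')| = 1` (`C' = 1`), and `RHS(E)·RHS(E_d) ≠ 0` cancelled.
[cite: Milne1972ArithmeticAV, §1 Thm. 1 and §2 (through DokchitserDokchitserAnnals2010, §2.1, proof of Thm. 2.3)]
[cite: GrossZagier1986, V.§2 (p. 311)] -/
theorem natIdentity_of_milne (hMilneC : Milne1972.bsdQuotient_baseChange_quadratic_anyModel)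
    [Finite W.sha] [Finite Wd.sha] :
    Finite (W.baseChange K).sha ∧
      W.shaOrder * Wd.shaOrder * W.tamagawaProduct * Wd.tamagawaProduct *
          (W.baseChange K).torsionOrder ^ 2 =
        (W.baseChange K).shaOrder * (W.baseChange K).tamagawaProduct *
          W.torsionOrder ^ 2 * Wd.torsionOrder ^ 2 * 2 := by
  have h2 : Module.finrank ℚ K = 2 := hK.1
  haveI : IsTotallyComplex K := hK.2
  haveI hEK : (W.baseChange K).IsElliptic := by rw [baseChange]; infer_instance
  have hV : ∃ C : VariableChange K, C • W.baseChange K = W.baseChange K := ⟨1, one_smul _ _⟩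
  -- Milne on the canonical model
  obtain ⟨hshaK, hWR⟩ := hMilneC W K h2 Wd ⟨Cd, hWd⟩ (W.baseChange K) hV ‹Finite W.sha› ‹Finite Wd.sha›
  haveI : Finite (W.baseChange K).sha := hshaK
  refine ⟨hshaK, ?_⟩
  have hmod := modifiedTamagawaProduct_baseChange_eq_tamagawaProduct_of_satisfiesHeegnerHypothesis W K
    h2 hH
  rw [hmod, Rat.cast_natCast] at hWR
  -- the archimedean and regulator factors
  have hA := realPeriod_mul_realPeriod_quadraticTwist_eq_mul_bsdPeriod W K h2
  have hn1 : (W.baseChange ℝ).numRealComponents = 1 := by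
    rw [numRealComponents_baseChange_real, if_neg (not_lt.mpr hΔ.le)]
  have hoddV : Odd (W.baseChange K).torsionOrder :=
    odd_torsionOrder_model_of_forall_two_nsmul_baseChange W K (W.baseChange K) hV h2t
  have hreg : (W.baseChange K).regulator = 2 * W.regulator * Wd.regulator :=
    regulator_baseChange_quadratic_eq_two_mul_of_rank_add_eq_one_of_odd W K h2 Wd ⟨Cd, hWd⟩
      (W.baseChange K) hV hr hoddV
  have hm : ((1 : ℕ) : ℝ) * (W.baseChange K).regulator = ((2 : ℕ) : ℝ) * (W.regulator * Wd.regulator) := by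
    rw [hreg]; push_cast; ring
  have key := milneQuotient_mul_eq_of_arch_of_regulator_gen W K Wd (W.baseChange K) hWd (C' := 1)
    (one_smul _ _) hA hm
  -- `Q(V) = R ≠ 0`, so `X = Y`
  have hR0 : W.bsdRHS * Wd.bsdRHS ≠ 0 :=
    mul_ne_zero (W.bsdRHS_ne_zero ‹Finite W.sha›) (Wd.bsdRHS_ne_zero ‹Finite Wd.sha›)
  rw [hWR] at key
  have hXY := mul_left_cancel₀ hR0 (key.trans (mul_comm _ _))
  -- read off the units: `n = 1`, `|u_d| = 1`, `|N(u')| = 1`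
  have hnorm : |Algebra.norm ℚ (((1 : VariableChange K).u : Kˣ) : K)| = 1 := by
    rw [show (((1 : VariableChange K).u : Kˣ) : K) = 1 from rfl, map_one, abs_one]
  rw [hn1, hu, hnorm] at hXY
  have hXYℚ : ((1 : ℕ) * (1 : ℚ) * W.shaOrder * Wd.shaOrder * W.tamagawaProduct * Wd.tamagawaProduct *
      (W.baseChange K).torsionOrder ^ 2 * (1 : ℕ) : ℚ) =
      (1 * (W.baseChange K).shaOrder * (W.baseChange K).tamagawaProduct *
        W.torsionOrder ^ 2 * Wd.torsionOrder ^ 2 * (2 : ℕ) : ℚ) := by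
    exact_mod_cast hXY
  have hXYℕ : ((W.shaOrder * Wd.shaOrder * W.tamagawaProduct * Wd.tamagawaProduct *
      (W.baseChange K).torsionOrder ^ 2 : ℕ) : ℚ) =
      (((W.baseChange K).shaOrder * (W.baseChange K).tamagawaProduct *
        W.torsionOrder ^ 2 * Wd.torsionOrder ^ 2 * 2 : ℕ) : ℚ) := by
    push_cast at hXYℚ ⊢
    linear_combination hXYℚ
  exact_mod_cast hXYℕ

include hK hodd hH hΔ hWd hu hr h2t in
/-- **`ord₂ #Ш(E_K) = ord₂ #Ш(E) + ord₂ #Ш(E^{(d_K)})`** (modulo Milne) on the habitat of the module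
docstring with `|d_K| = q` prime and `(Δ_E/q) = −1`: take `ord₂` of `natIdentity_of_milne` and
substitute `∏c(E_K) = (∏c(E))²` (IIIa), `ord₂ ∏c(E_d) = ord₂ ∏c(E) + 1` (IIIb),
`#E(K)_t = #E(ℚ)_t·#E_d(ℚ)_t` (II); the regulator's `2` and `c_q(E_d) = 2` cancel.
[cite: Milne1972ArithmeticAV, §1 Thm. 1 and §2 (through DokchitserDokchitserAnnals2010, §2.1, proof of Thm. 2.3)]
[cite: Kramer1981, Prop. 3] [cite: GrossZagier1986, V.§2 (p. 311)] -/
theorem padicValNat_two_shaOrder_baseChange_eq_add_of_milne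
    (hMilneC : Milne1972.bsdQuotient_baseChange_quadratic_anyModel)
    (hq : (NumberField.discr K).natAbs.Prime) (hjac : jacobiSym W.Δ.num (NumberField.discr K).natAbs = -1)
    [Finite W.sha] [Finite Wd.sha] :
    Finite (W.baseChange K).sha ∧
      padicValNat 2 (W.baseChange K).shaOrder = padicValNat 2 W.shaOrder + padicValNat 2 Wd.shaOrder := by
  haveI : Fact (Nat.Prime 2) := ⟨Nat.prime_two⟩
  have h2 : Module.finrank ℚ K = 2 := hK.1
  haveI hEK : (W.baseChange K).IsElliptic := by rw [baseChange]; infer_instance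
  obtain ⟨hshaK, hid⟩ := natIdentity_of_milne W K hK hH hΔ Wd Cd hWd hu hr h2t hMilneC
  haveI : Finite (W.baseChange K).sha := hshaK
  refine ⟨hshaK, ?_⟩
  have hV : ∃ C : VariableChange K, C • W.baseChange K = W.baseChange K := ⟨1, one_smul _ _⟩
  -- the exact local inputs at `2`
  have hTK : (W.baseChange K).tamagawaProduct = W.tamagawaProduct ^ 2 :=
    tamagawaProduct_baseChange_eq_sq_of_heegner W K h2 hH
  have hTd : padicValNat 2 Wd.tamagawaProduct = padicValNat 2 W.tamagawaProduct + 1 :=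
    padicValNat_two_tamagawaProduct_twist_of_heegner_of_jacobiSym_eq_neg_one W K hK hodd hH Cd hWd hq
      hjac
  have htor : (W.baseChange K).torsionOrder = W.torsionOrder * Wd.torsionOrder :=
    torsionOrder_baseChange_quadratic_eq_mul_of_forall_two_nsmul W K h2 Wd ⟨Cd, hWd⟩ (W.baseChange K)
      hV h2t
  -- non-vanishing
  have hS0 : W.shaOrder ≠ 0 := (W.shaOrder_pos ‹Finite W.sha›).ne'
  have hSd0 : Wd.shaOrder ≠ 0 := (Wd.shaOrder_pos ‹Finite Wd.sha›).ne'
  have hSK0 : (W.baseChange K).shaOrder ≠ 0 := ((W.baseChange K).shaOrder_pos hshaK).ne'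
  have hT0 : W.tamagawaProduct ≠ 0 := W.tamagawaProduct_pos'.ne'
  have hTd0 : Wd.tamagawaProduct ≠ 0 := Wd.tamagawaProduct_pos'.ne'
  have ht0 : W.torsionOrder ≠ 0 := W.torsionOrder_pos_holds.ne'
  have htd0 : Wd.torsionOrder ≠ 0 := Wd.torsionOrder_pos_holds.ne'
  rw [hTK, htor] at hid
  -- `ord₂` of both sides
  have hv := congrArg (padicValNat 2) hid
  rw [padicValNat.mul (mul_ne_zero (mul_ne_zero (mul_ne_zero hS0 hSd0) hT0) hTd0)
        (pow_ne_zero 2 (mul_ne_zero ht0 htd0)),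
    padicValNat.mul (mul_ne_zero (mul_ne_zero hS0 hSd0) hT0) hTd0,
    padicValNat.mul (mul_ne_zero hS0 hSd0) hT0, padicValNat.mul hS0 hSd0,
    padicValNat.mul (mul_ne_zero (mul_ne_zero (mul_ne_zero hSK0 (pow_ne_zero 2 hT0))
        (pow_ne_zero 2 ht0)) (pow_ne_zero 2 htd0)) two_ne_zero,
    padicValNat.mul (mul_ne_zero (mul_ne_zero hSK0 (pow_ne_zero 2 hT0)) (pow_ne_zero 2 ht0))
      (pow_ne_zero 2 htd0),
    padicValNat.mul (mul_ne_zero hSK0 (pow_ne_zero 2 hT0)) (pow_ne_zero 2 ht0),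
    padicValNat.mul hSK0 (pow_ne_zero 2 hT0), padicValNat.pow, padicValNat.pow, padicValNat.pow,
    padicValNat.pow, padicValNat.mul ht0 htd0, hTd, padicValNat_self] at hv
  omega

include hK hodd hH hΔ hWd hu hr h2t in
/-- **THE COUNT IDENTITY `#Ш(E_K)[2^∞] = #Ш(E/ℚ)[2^∞] · #Ш(E^{(d_K)}/ℚ)[2^∞]` (modulo Milne).**
`W/ℚ` globally minimal elliptic with `Δ < 0`; `K` imaginary quadratic with `d_K` odd, `|d_K| = q`
prime, `(Δ_E/q) = −1`, satisfying the Heegner hypothesis for the conductor; `Wd = Cd • W^{(d_K)}`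
globally minimal with `|u_d| = 1`; `rank E(ℚ) + rank Wd(ℚ) = 1`; `E(K)` without points of order
`2`; `Ш(E/ℚ)`, `Ш(Wd/ℚ)` finite. THEN `Ш(E_K)` is finite and
`#Ш(E_K)[2^∞] = #Ш(E)[2^∞] · #Ш(Wd)[2^∞]` (`#A[2^∞] = 2^{ord₂ #A}`,
`natCard_primaryComponent_eq_pow_padicValNat`). This is the bridge from the pair telescope's
`#Ш(E^{ε})[2^∞]·#Ш(E^{−ε})[2^∞] ≤ 2^{2M₀}` to the crux's `#Ш(E_K)[2^∞]`; on the route's habitat H₂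
with prime `|d_K|` every hypothesis but Milne's theorem is available (`Δ < 0` and `(Δ/q) = −1`:
`ℚ(√Δ) = F` with `q` inert in `F`; no `2`-torsion: `ρ̄_{E,2}` onto; total rank one and finiteness:
Gross–Zagier–Kolyvagin). [cite: Milne1972ArithmeticAV, §1 Thm. 1 and §2 (through DokchitserDokchitserAnnals2010, §2.1, proof of Thm. 2.3)]
[cite: Kramer1981, Prop. 3] [cite: GrossZagier1986, V.§2 (p. 311)] -/
theorem card_primaryComponent_sha_two_baseChange_eq_mul_of_milne
    (hMilneC : Milne1972.bsdQuotient_baseChange_quadratic_anyModel)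
    (hq : (NumberField.discr K).natAbs.Prime) (hjac : jacobiSym W.Δ.num (NumberField.discr K).natAbs = -1)
    [Finite W.sha] [Finite Wd.sha] :
    Finite (W.baseChange K).sha ∧
      Nat.card (AddCommGroup.primaryComponent (W.baseChange K).sha 2) =
        Nat.card (AddCommGroup.primaryComponent W.sha 2) *
          Nat.card (AddCommGroup.primaryComponent Wd.sha 2) := by
  haveI : Fact (Nat.Prime 2) := ⟨Nat.prime_two⟩
  obtain ⟨hshaK, hv⟩ := padicValNat_two_shaOrder_baseChange_eq_add_of_milne W K hK hodd hH hΔ Wd Cd hWd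
    hu hr h2t hMilneC hq hjac
  haveI : Finite (W.baseChange K).sha := hshaK
  refine ⟨hshaK, ?_⟩
  rw [natCard_primaryComponent_eq_pow_padicValNat 2, natCard_primaryComponent_eq_pow_padicValNat 2,
    natCard_primaryComponent_eq_pow_padicValNat 2, ← pow_add]
  exact congrArg (2 ^ ·) hv

end Summit.BirchSwinnertonDyer.BirchSwinnertonDyer.Theorems.ShaCountTwo

end
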